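import Literature.MathematicalPhysics.QuantumFieldTheory.TorusChartCurlPrimitive
import HarnessLib

/-!
# Fluxes of closed plaquette fields do not depend on the plane; small closed vortex currents are curls

Continuation of the degree-two Poincaré lemma on a charted torus (`TorusChartCurlPrimitive.lean`:
`exists_d₁_eq_iff`, a `2`-cochain is a curl iff alternating, closed and with zero fluxes through the coordinate
`2`-tori THROUGH THE ORIGIN).  Here:

* `TorusChart.fluxAt F q i j x` — the flux through the coordinate `2`-torus `(i, j)` through an arbitrary point `x`;
* `TorusChart.fluxAt_add_gen`, `TorusChart.fluxAt_eq_flux` — **for a closed `q` the flux does not depend on the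
  position of the plane** (closedness on the `3`-cells `(k, i, j)` summed over the plane: the `i`-differences die
  around the `i`-circle and the `j`-differences telescope around the `j`-circle); so `flux` is a homology
  invariant, the pairing of `q` with the coordinate `2`-cycles;
* `TorusChart.flux_eq_zero_of_vanish_on_planes`, `TorusChart.exists_d₁_eq_of_vanish_on_planes` — **a closed
  alternating `2`-cochain vanishing on some translate of every coordinate plane is a curl**; in particular every
  vortex current whose support is smaller than the torus in each direction (the input "a vortex loop that does
  not wrap around the torus is a boundary" of vortex cluster expansions; compare the `ℤ^d`-based
  `LatticeForm.exists_td₁_eq_of_liftBox` of `AbelianTorusCochains.lean`, which needs the support in a box away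
  from the seam).

Everything is proved; no named fact is introduced. [folklore]
-/

namespace Literature.MathematicalPhysics.QuantumFieldTheory

open scoped BigOperators

namespace TorusChart

variable {Λ : Type*} [AddCommGroup Λ] {d : ℕ} (F : TorusChart Λ d)
variable {A : Type*} [AddCommGroup A]

/-! ## The flux through a translated plane -/

/-- The flux of `q` through the coordinate `2`-torus in directions `(i, j)` **through the point `x`** (only the
coordinates of `x` other than `i, j` matter). [folklore] -/
def fluxAt (q : Λ → Fin d → Fin d → A) (i j : Fin d) (x : Λ) : A :=
  ∑ m ∈ Finset.range (F.period j), F.circSum i (fun y => q y i j) (F.dropCoord i (F.dropCoord j x) + m • F.gen j)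

/-- The flux through the plane through the origin is `flux`. [folklore] -/
theorem fluxAt_zero (q : Λ → Fin d → Fin d → A) (i j : Fin d) : F.fluxAt q i j 0 = F.flux q i j := by
  simp only [fluxAt, flux, dropCoord_zero, zero_add]

/-- The base point of the plane through `x` does not move under steps in the plane directions. [folklore] -/
theorem dropCoord_dropCoord_add_gen_fst (i j : Fin d) (x : Λ) :
    F.dropCoord i (F.dropCoord j (x + F.gen i)) = F.dropCoord i (F.dropCoord j x) := by
  by_cases hij : i = j
  · subst hij; rw [dropCoord_add_gen_self]
  · rw [F.dropCoord_add_gen_of_ne hij, dropCoord_add_gen_self]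

/-- The base point of the plane through `x` does not move under steps in the plane directions. [folklore] -/
theorem dropCoord_dropCoord_add_gen_snd (i j : Fin d) (x : Λ) :
    F.dropCoord i (F.dropCoord j (x + F.gen j)) = F.dropCoord i (F.dropCoord j x) := by
  rw [dropCoord_add_gen_self]

/-- The base point of the plane through `x` moves along with transverse steps. [folklore] -/
theorem dropCoord_dropCoord_add_gen_of_ne {i j k : Fin d} (hki : k ≠ i) (hkj : k ≠ j) (x : Λ) :
    F.dropCoord i (F.dropCoord j (x + F.gen k)) = F.dropCoord i (F.dropCoord j x) + F.gen k := by
  rw [F.dropCoord_add_gen_of_ne hkj, F.dropCoord_add_gen_of_ne hki]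

variable {F} in
/-- **The flux of a closed `2`-cochain through a coordinate plane does not depend on the position of the
plane**: invariance under a unit step of the base point. (For the transverse directions this is closedness on
the cells `(k, i, j)` summed over the plane; the in-plane directions do not move the plane.) [folklore] -/
theorem fluxAt_add_gen {q : Λ → Fin d → Fin d → A} (hq : F.d₂ q = 0) (i j : Fin d) (x : Λ) (k : Fin d) :
    F.fluxAt q i j (x + F.gen k) = F.fluxAt q i j x := by
  by_cases hki : k = i
  · subst hki; rw [fluxAt, fluxAt, dropCoord_dropCoord_add_gen_fst]
  by_cases hkj : k = j
  · subst hkj; rw [fluxAt, fluxAt, dropCoord_dropCoord_add_gen_snd]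
  rw [fluxAt, fluxAt, F.dropCoord_dropCoord_add_gen_of_ne hki hkj]
  set b : Λ := F.dropCoord i (F.dropCoord j x) with hb
  rw [← sub_eq_zero, ← Finset.sum_sub_distrib]
  -- closedness on the cell `(y; k, i, j)`: `∂_k q_{ij} = ∂_i q_{kj} - ∂_j q_{ki}`
  have hcell : ∀ y : Λ, q (y + F.gen k) i j - q y i j =
      (q (y + F.gen i) k j - q y k j) - (q (y + F.gen j) k i - q y k i) := fun y => by
    have h := congr_fun (congr_fun (congr_fun (congr_fun hq y) k) i) j
    simp only [d₂_apply, Pi.zero_apply] at h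
    rw [← sub_eq_zero, ← h]
    abel
  by_cases hij : i = j
  · -- degenerate plane: `q_{ii}` is invariant in direction `k`
    refine Finset.sum_eq_zero fun m _ => ?_
    rw [add_right_comm, F.circSum_add_gen_of_ne hki, ← circSum_sub]
    refine F.circSum_eq_zero_of_forall i (fun y => ?_) _
    rw [hcell]
    subst hij
    exact sub_self _
  -- the first difference dies around the `i`-circle, the second telescopes in `m` around the `j`-circle
  have hterm : ∀ m : ℕ, F.circSum i (fun y => q y i j) (b + F.gen k + m • F.gen j) -
      F.circSum i (fun y => q y i j) (b + m • F.gen j) =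
      -(F.circSum i (fun y => q y k i) (b + (m + 1) • F.gen j) - F.circSum i (fun y => q y k i) (b + m • F.gen j)) := by
    intro m
    rw [add_right_comm, F.circSum_add_gen_of_ne hki, ← circSum_sub, succ_nsmul, ← add_assoc,
      F.circSum_add_gen_of_ne (Ne.symm hij), ← circSum_sub, ← circSum_neg]
    have hfun : (fun y => q (y + F.gen k) i j - q y i j) =
        fun y => (q (y + F.gen i) k j - q y k j) + -(q (y + F.gen j) k i - q y k i) := by
      funext y; rw [hcell, sub_eq_add_neg]
    rw [hfun, circSum_add, F.circSum_sub_add_gen_self i (fun y => q y k j), zero_add]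
  simp only [hterm, Finset.sum_neg_distrib, neg_eq_zero]
  rw [Finset.sum_range_sub (fun m => F.circSum i (fun y => q y k i) (b + m • F.gen j)), F.add_period_nsmul_gen,
    zero_nsmul, add_zero, sub_self]

variable {F} in
/-- The flux of a closed `2`-cochain through a coordinate plane does not depend on the position of the plane:
invariance under several unit steps. [folklore] -/
theorem fluxAt_add_nsmul_gen {q : Λ → Fin d → Fin d → A} (hq : F.d₂ q = 0) (i j : Fin d) (x : Λ) (k : Fin d) :
    ∀ n : ℕ, F.fluxAt q i j (x + n • F.gen k) = F.fluxAt q i j x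
  | 0 => by rw [zero_nsmul, add_zero]
  | n + 1 => by rw [succ_nsmul, ← add_assoc, fluxAt_add_gen hq, fluxAt_add_nsmul_gen hq i j x k n]

variable {F} in
/-- **The flux of a closed `2`-cochain through any translate of a coordinate plane is its flux.** [folklore] -/
theorem fluxAt_eq_flux {q : Λ → Fin d → Fin d → A} (hq : F.d₂ q = 0) (i j : Fin d) (x : Λ) :
    F.fluxAt q i j x = F.flux q i j := by
  rw [← fluxAt_zero, F.eq_sum_cval_nsmul_gen x]
  induction (Finset.univ : Finset (Fin d)) using Finset.induction_on with
  | empty => rw [Finset.sum_empty]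
  | insert a s ha ih => rw [Finset.sum_insert ha, add_comm, ← zero_add (_ + _), ← add_assoc,
      fluxAt_add_nsmul_gen hq, zero_add, ih]

variable {F} in
/-- **A closed `2`-cochain vanishing on some translate of each coordinate plane has zero fluxes** — e.g. a
vortex current whose support is smaller than the torus in every direction. [folklore] -/
theorem flux_eq_zero_of_vanish_on_planes {q : Λ → Fin d → Fin d → A} (hq : F.d₂ q = 0)
    (hmiss : ∀ i j : Fin d, i ≠ j → ∃ x : Λ, ∀ (m n : ℕ),
      q (F.dropCoord i (F.dropCoord j x) + m • F.gen j + n • F.gen i) i j = 0)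
    (hdiag : ∀ (x : Λ) (i : Fin d), q x i i = 0) (i j : Fin d) : F.flux q i j = 0 := by
  by_cases hij : i = j
  · rw [flux]
    subst hij
    exact Finset.sum_eq_zero fun m _ => F.circSum_eq_zero_of_forall _ (fun y => hdiag y _) _
  obtain ⟨x, hx⟩ := hmiss i j hij
  rw [← fluxAt_eq_flux hq i j x, fluxAt]
  refine Finset.sum_eq_zero fun m _ => ?_
  rw [circSum, F.dropCoord_of_cval_eq_zero]
  · exact Finset.sum_eq_zero fun n _ => hx m n
  · rw [F.cval_add_nsmul_gen_of_ne hij, cval_dropCoord_self]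

variable {F} in
/-- **Small closed vortex currents are curls**: an alternating closed `2`-cochain that vanishes on some
translate of every coordinate plane is `d₁ θ` for some `1`-cochain `θ`. [folklore] -/
theorem exists_d₁_eq_of_vanish_on_planes {q : Λ → Fin d → Fin d → A} (halt : IsAlt₂ q) (hq : F.d₂ q = 0)
    (hmiss : ∀ i j : Fin d, i ≠ j → ∃ x : Λ, ∀ (m n : ℕ),
      q (F.dropCoord i (F.dropCoord j x) + m • F.gen j + n • F.gen i) i j = 0) :
    ∃ θ : Λ → Fin d → A, F.d₁ θ = q :=
  (F.exists_d₁_eq_iff q).2 ⟨halt, hq, flux_eq_zero_of_vanish_on_planes hq hmiss halt.diag⟩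

end TorusChart

end Literature.MathematicalPhysics.QuantumFieldTheory
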